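import Literature.Computability.AlgebraicComplexity.BDI20WaringRankABPWidth
import HarnessLib

/-!
# Nisan's width theorem for noncommutative ABPs (Bläser–Dörfler–Ikenmeyer 2020, Prop. 6.6) —
# PROOF of the typed fact `BDI2020_prop_6_6`

Topic: `Literature/Computability/AlgebraicComplexity`. Sources: M. Bläser, J. Dörfler, C. Ikenmeyer,
*On the complexity of evaluating highest weight vectors*, CCC 2021 (LIPIcs 200) 29 =
arXiv:2002.11594 [BlaserDorflerIkenmeyer2020], Prop. 6.6 (arXiv Prop. 12); N. Nisan, *Lower bounds
for non-commutative computation*, STOC 1991 [Nisan1991], Thm. 1 and its proof. Theorem-only file: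
it discharges `BDI2020_prop_6_6` of the statement file `BDI20WaringRankABPWidth.lean` (typer x6),
namely: a tensor `Ψ ∈ ⊗^d F^m` is computed by a noncommutative ABP of width `≤ w`
(`BDI2020.HasNcABPWidthLE w Ψ`, transfer-matrix form) iff all its sequential flattenings
`M_k(Ψ)` have rank `≤ w` (`wordTTRank Ψ ≤ w`, file `WordLiftWidth.lean`). The symmetry hypothesis
of the printed proposition is not needed for this clause (Nisan's theorem holds for every tensor /
homogeneous noncommutative polynomial), so it is proved for all `Ψ` and every field.

## The printed proofs and their rendering

* (⇒) BDI p.29:12, proof of Prop. 6.6: "`M_k = L_k R_k`, where `L_k` is the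
  `m^k × dim V_k`-matrix whose entry at position `((i_1,…,i_k), v)` equals the coefficient of
  `e_{i_1} ⊗ ⋯ ⊗ e_{i_k}` computed at the node `v` and `R_k` contains the coefficients of the
  "complementary" tensors" — here, with the program in transfer-matrix form
  `Ψ(i) = uᵀ C_1[i_1] ⋯ C_d[i_d] v`, the row `uᵀ C_1[i_1] ⋯ C_a[i_a]` and the column
  `C_{a+1}[i_{a+1}] ⋯ C_d[i_d] v` (`Nisan.wordFlattening_eq_mul`, via `List.ofFn_add`), so
  `rank M_a ≤ w` (`Nisan.rank_wordFlattening_le_of_hasNcABPWidthLE`).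
* (⇐) Nisan's construction (STOC 1991, proof of Thm. 1; BDI p.29:12 "the `k`-th layer of `B` has
  precisely `dim ∂^{=k}(p)` many vertices"): the nodes of layer `k` are a basis of the span `V_k`
  of the `k`-fold "partial derivatives" (slices `s ↦ Ψ(p·s)`, `|p| = k`, i.e. the ROW SPACE of
  `M_k`), and the edge `v → v'` labelled `x` carries the coordinate of the slice `∂_x v` in the basis
  of `V_{k+1}`. Rendered as an induction on the order `d` over SUBSPACES of tensors
  (`Nisan.Good`, `Nisan.exists_abp_of_good`: uniform layers `C`, sink vector `v`, and a LINEAR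
  start-vector map `L`), the layer widths padded to `w` by zero rows (`Nisan.exists_coords`); the
  identification of the iterated slice spans with the row spaces of the flattenings is
  `Nisan.good_span_of_rank_le` (via `Fin.append_cons`, `Fin.elim0_append`).
* Assembly: `BDI2020.hasNcABPWidthLE_iff_wordTTRank_le` and `BDI2020_prop_6_6_holds`.

Honest framing (val-lit): a discharge of a published, proved statement; nothing here bears on
`VP ≠ VNP`.

## References

* [BlaserDorflerIkenmeyer2020] CCC 2021 Prop. 6.6 = arXiv:2002.11594 Prop. 12 (p0011:L56–78).
* [Nisan1991] N. Nisan, STOC 1991, Thm. 1 (the rank characterisation of homogeneous ABP size /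
  width).
-/

noncomputable section

open Matrix Module

namespace Literature.Computability.AlgebraicComplexity

namespace BDI2020

namespace Nisan

variable {F : Type*} [Field F] {m : ℕ}

/-! ### Transfer-matrix evaluation, slices, and the slice span -/

/-- The value `uᵀ C_1[i_1] ⋯ C_d[i_d] v` of a transfer-matrix program at the word `i`
(the right-hand side of `HasNcABPWidthLE`). [cite: BlaserDorflerIkenmeyer2020, Def 6.1 (CCC 2021) = arXiv Def 7] -/
def abpEval {d w : ℕ} (C : Fin d → Fin m → Matrix (Fin w) (Fin w) F) (u v : Fin w → F)
    (i : Fin d → Fin m) : F :=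
  u ⬝ᵥ ((List.ofFn fun t => C t (i t)).prod *ᵥ v)

/-- The slice ("partial derivative") `∂_x Φ : s ↦ Φ(x·s)` of a tensor of order `d + 1`.
[cite: Nisan1991, Thm. 1 (proof)] -/
def slice {d : ℕ} (x : Fin m) (Φ : (Fin (d + 1) → Fin m) → F) : (Fin d → Fin m) → F :=
  fun s => Φ (Fin.cons x s)

/-- The slice is linear in the tensor. [cite: Nisan1991, Thm. 1 (proof)] -/
def sliceₗ {d : ℕ} (x : Fin m) : ((Fin (d + 1) → Fin m) → F) →ₗ[F] ((Fin d → Fin m) → F) where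
  toFun := slice x
  map_add' _ _ := rfl
  map_smul' _ _ := rfl

/-- Unfolding lemma. [cite: Nisan1991, Thm. 1 (proof)] -/
@[simp] theorem sliceₗ_apply {d : ℕ} (x : Fin m) (Φ : (Fin (d + 1) → Fin m) → F) :
    sliceₗ x Φ = slice x Φ := rfl

/-- The span of all slices of a space of tensors (Nisan's `V_{k+1}` from `V_k`).
[cite: Nisan1991, Thm. 1 (proof)] -/
def sliceSpan {d : ℕ} (𝒱 : Submodule F ((Fin (d + 1) → Fin m) → F)) :
    Submodule F ((Fin d → Fin m) → F) :=
  ⨆ x : Fin m, 𝒱.map (sliceₗ x)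

/-- Slices of members lie in the slice span. [cite: Nisan1991, Thm. 1 (proof)] -/
theorem slice_mem_sliceSpan {d : ℕ} {𝒱 : Submodule F ((Fin (d + 1) → Fin m) → F)}
    {Φ : (Fin (d + 1) → Fin m) → F} (hΦ : Φ ∈ 𝒱) (x : Fin m) : slice x Φ ∈ sliceSpan 𝒱 :=
  Submodule.mem_iSup_of_mem x (Submodule.mem_map_of_mem (f := sliceₗ x) hΦ)

/-- The slice span is monotone. [cite: Nisan1991, Thm. 1 (proof)] -/
theorem sliceSpan_mono {d : ℕ} {𝒱 𝒱' : Submodule F ((Fin (d + 1) → Fin m) → F)} (h : 𝒱 ≤ 𝒱') :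
    sliceSpan 𝒱 ≤ sliceSpan 𝒱' :=
  iSup_mono fun _ => Submodule.map_mono h

/-- **Nisan's rank condition, recursively**: a space of order-`d` tensors is `w`-good if it has
dimension `≤ w` and (for `d ≥ 1`) its slice span is `w`-good. For the span of the slices
`{∂_p Ψ}` this says `rank M_k(Ψ) ≤ w` for all `k` (`good_span_of_rank_le`).
[cite: Nisan1991, Thm. 1 (proof)] -/
def Good (w : ℕ) : (d : ℕ) → Submodule F ((Fin d → Fin m) → F) → Prop
  | 0, 𝒱 => finrank F 𝒱 ≤ w
  | d + 1, 𝒱 => finrank F 𝒱 ≤ w ∧ Good w d (sliceSpan 𝒱)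

/-- Goodness is inherited by subspaces. [cite: Nisan1991, Thm. 1 (proof)] -/
theorem Good.mono (w : ℕ) : ∀ (d : ℕ) {𝒱 𝒱' : Submodule F ((Fin d → Fin m) → F)},
    Good w d 𝒱' → 𝒱 ≤ 𝒱' → Good w d 𝒱
  | 0, _, _, h, hle => (Submodule.finrank_mono hle).trans h
  | d + 1, _, _, h, hle =>
    ⟨(Submodule.finrank_mono hle).trans h.1, Good.mono w d h.2 (sliceSpan_mono hle)⟩

/-! ### Coordinates padded to width `w` -/

/-- Coordinates on a subspace of dimension `≤ w`, padded with zeros to vectors of length `w`: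
a spanning family `b` in `𝒱`, a linear coordinate map `κ` into `F^w` factoring through an
isometric padding matrix `E` (`Eᵀ E = 1`), and the expansion `Φ = Σ_j c_j b_j` with `κ Φ = E c`
for `Φ ∈ 𝒱`. (The zero rows are the "padding of every layer to `w` vertices".)
[cite: Nisan1991, Thm. 1 (proof)] -/
theorem exists_coords {V : Type*} [AddCommGroup V] [Module F V] [FiniteDimensional F V]
    (𝒱 : Submodule F V) {w : ℕ} (h : finrank F 𝒱 ≤ w) :
    ∃ (n₀ : ℕ) (b : Fin n₀ → V) (κ : V →ₗ[F] (Fin w → F)) (E : Matrix (Fin w) (Fin n₀) F),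
      (∀ j, b j ∈ 𝒱) ∧ Eᵀ * E = 1 ∧
      ∀ Φ ∈ 𝒱, ∃ c : Fin n₀ → F, κ Φ = E *ᵥ c ∧ Φ = ∑ j, c j • b j := by
  classical
  set n₀ := finrank F 𝒱
  let b𝒱 : Basis (Fin n₀) F 𝒱 := Module.finBasisOfFinrankEq F 𝒱 rfl
  obtain ⟨π, hπ⟩ := LinearMap.exists_leftInverse_of_injective 𝒱.subtype (Submodule.ker_subtype 𝒱)
  let ι' : Fin n₀ → Fin w := Fin.castLE h
  have hι' : Function.Injective ι' := Fin.castLE_injective h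
  let E : Matrix (Fin w) (Fin n₀) F := (1 : Matrix (Fin w) (Fin w) F).submatrix id ι'
  have hE : Eᵀ * E = 1 := by
    have h1 : Eᵀ = (1 : Matrix (Fin w) (Fin w) F).submatrix ι' id := by
      rw [Matrix.transpose_submatrix, Matrix.transpose_one]
    have h2 := Matrix.submatrix_mul (1 : Matrix (Fin w) (Fin w) F) (1 : Matrix (Fin w) (Fin w) F)
      ι' (id : Fin w → Fin w) ι' Function.bijective_id
    rw [Matrix.mul_one, Matrix.submatrix_one ι' hι'] at h2
    rw [h1]
    exact h2.symm
  refine ⟨n₀, fun j => (b𝒱 j : V), E.mulVecLin ∘ₗ (b𝒱.equivFun.toLinearMap ∘ₗ π), E,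
    fun j => (b𝒱 j).2, hE, fun Φ hΦ => ?_⟩
  have hπΦ : π Φ = ⟨Φ, hΦ⟩ := by
    have := congrArg (fun f : 𝒱 →ₗ[F] 𝒱 => f ⟨Φ, hΦ⟩) hπ
    simpa using this
  refine ⟨b𝒱.equivFun (π Φ), rfl, ?_⟩
  have hsum := b𝒱.sum_equivFun (π Φ)
  rw [hπΦ] at hsum
  have := congrArg (fun v : 𝒱 => (v : V)) hsum
  simp only [Submodule.coe_sum, Submodule.coe_smul] at this
  rw [hπΦ]
  exact this.symm

/-- With an isometric padding `E`: `(E c)ᵀ (E R) = cᵀ R`. [cite: Nisan1991, Thm. 1 (proof)] -/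
theorem mulVec_vecMul_mul {w n₀ : ℕ} {ρ : Type*} (E : Matrix (Fin w) (Fin n₀) F) (hE : Eᵀ * E = 1)
    (c : Fin n₀ → F) (R : Matrix (Fin n₀) ρ F) : (E *ᵥ c) ᵥ* (E * R) = c ᵥ* R := by
  rw [Matrix.vecMul_mulVec, ← Matrix.mul_assoc, hE, Matrix.one_mul]

/-- With an isometric padding `E`: `(E c) · (E y) = c · y`. [cite: Nisan1991, Thm. 1 (proof)] -/
theorem mulVec_dotProduct_mulVec {w n₀ : ℕ} (E : Matrix (Fin w) (Fin n₀) F) (hE : Eᵀ * E = 1)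
    (c y : Fin n₀ → F) : (E *ᵥ c) ⬝ᵥ (E *ᵥ y) = c ⬝ᵥ y := by
  rw [Matrix.dotProduct_mulVec, Matrix.vecMul_mulVec, hE, Matrix.vecMul_one]

/-! ### Nisan's construction: a `w`-good space of tensors has a uniform width-`w` program -/

/-- **Nisan's construction (⇐ of the width theorem), for spaces of tensors**: if `𝒱` is
`w`-good there are layers `C_1, …, C_d` of `w × w` transfer matrices, a sink vector `v` and a
LINEAR start map `L` with `Φ(i) = L(Φ)ᵀ C_1[i_1] ⋯ C_d[i_d] v` for every `Φ ∈ 𝒱` and every word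
`i`. Induction on `d`: the first layer sends the coordinates of `Φ` (in a basis of `𝒱`) to those
of its slices `∂_x Φ` (in a basis of the slice span), which the program of the slice span computes.
[cite: Nisan1991, Thm. 1 (proof)] -/
theorem exists_abp_of_good (w : ℕ) : ∀ (d : ℕ) (𝒱 : Submodule F ((Fin d → Fin m) → F)),
    Good w d 𝒱 →
    ∃ (C : Fin d → Fin m → Matrix (Fin w) (Fin w) F) (v : Fin w → F)
      (L : ((Fin d → Fin m) → F) →ₗ[F] (Fin w → F)),
      ∀ Φ ∈ 𝒱, ∀ i, Φ i = abpEval C (L Φ) v i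
  | 0, 𝒱, h => by
    classical
    obtain ⟨n₀, b, κ, E, hb, hE, hκ⟩ := exists_coords 𝒱 h
    -- the unique word of length `0`
    let i₀ : Fin 0 → Fin m := fun t => t.elim0
    refine ⟨fun t => t.elim0, E *ᵥ fun j => b j i₀, κ, fun Φ hΦ i => ?_⟩
    obtain ⟨c, hκc, hΦc⟩ := hκ Φ hΦ
    have hi : i = i₀ := Subsingleton.elim _ _
    subst hi
    simp only [abpEval, List.ofFn_zero, List.prod_nil, Matrix.one_mulVec, hκc,
      mulVec_dotProduct_mulVec E hE]
    rw [hΦc]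
    simp [dotProduct, Finset.sum_apply, Pi.smul_apply, smul_eq_mul]
  | d + 1, 𝒱, ⟨h0, h1⟩ => by
    classical
    obtain ⟨C', v, L', hL'⟩ := exists_abp_of_good w d (sliceSpan 𝒱) h1
    obtain ⟨n₀, b, κ, E, hb, hE, hκ⟩ := exists_coords 𝒱 h0
    -- first layer: row `j` of `R x` = start vector of the slice `∂_x b_j` in the program of the
    -- slice span; padded to `w × w` by `E`
    let R : Fin m → Matrix (Fin n₀) (Fin w) F := fun x j => L' (slice x (b j))
    refine ⟨Fin.cons (fun x => E * R x) C', v, κ, fun Φ hΦ i => ?_⟩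
    obtain ⟨c, hκc, hΦc⟩ := hκ Φ hΦ
    -- `Φ(i) = (∂_{i₀} Φ)(tail i) = Σ_j c_j (∂_{i₀} b_j)(tail i)`
    have hslice : Φ i = ∑ j, c j * slice (i 0) (b j) (Fin.tail i) := by
      conv_lhs => rw [← Fin.cons_self_tail i, hΦc]
      simp [slice, Finset.sum_apply, Pi.smul_apply, smul_eq_mul]
    -- each slice of a basis vector is computed by the program of the slice span
    have hprog : ∀ j, slice (i 0) (b j) (Fin.tail i) =
        abpEval C' (L' (slice (i 0) (b j))) v (Fin.tail i) :=
      fun j => hL' _ (slice_mem_sliceSpan (hb j) (i 0)) (Fin.tail i)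
    rw [hslice]
    simp only [hprog, abpEval]
    -- unfold the first layer of the new program
    rw [List.ofFn_succ, List.prod_cons, Fin.cons_zero, hκc]
    simp only [Fin.cons_succ]
    rw [← Matrix.mulVec_mulVec, Matrix.dotProduct_mulVec, mulVec_vecMul_mul E hE,
      ← Matrix.dotProduct_mulVec]
    simp only [dotProduct, Matrix.mulVec, R]
    rfl

/-! ### The slice spans of `span {Ψ}` are the row spaces of the flattenings -/

/-- The set of rows of the flattenings `M_{a,b}(Φ)`, `Φ ∈ 𝒮`. [cite: Nisan1991, §2] -/
def rowSet {d : ℕ} (𝒮 : Set ((Fin d → Fin m) → F)) (a b : ℕ) (h : a + b = d) :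
    Set ((Fin b → Fin m) → F) :=
  ⋃ Φ ∈ 𝒮, Set.range (wordFlattening Φ a b h)

omit [Field F] in
/-- At the cut `0 | d` the rows of `M_0(Φ)` are `Φ` itself. [cite: Nisan1991, §2] -/
theorem wordFlattening_zero_row {d : ℕ} (Φ : (Fin d → Fin m) → F) (p : Fin 0 → Fin m) :
    wordFlattening Φ 0 d (Nat.zero_add d) p = Φ := by
  funext s
  rw [wordFlattening_apply]
  have hp : p = Fin.elim0 := funext fun t => t.elim0
  subst hp
  congr 1
  funext t
  rw [Fin.elim0_append, Function.comp_apply]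
  exact congrArg s (Fin.ext rfl)

omit [Field F] in
/-- At the cut `0 | d` the row set of `𝒮` is `𝒮`. [cite: Nisan1991, §2] -/
theorem rowSet_zero {d : ℕ} (𝒮 : Set ((Fin d → Fin m) → F)) :
    rowSet 𝒮 0 d (Nat.zero_add d) = 𝒮 := by
  ext Φ
  simp only [rowSet, Set.mem_iUnion, Set.mem_range, exists_prop]
  constructor
  · rintro ⟨Φ', hΦ', p, rfl⟩
    rwa [wordFlattening_zero_row]
  · intro hΦ
    exact ⟨Φ, hΦ, fun t => t.elim0, wordFlattening_zero_row Φ _⟩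

omit [Field F] in
/-- A row of `M_{a,b}(∂_x Φ)` at the prefix `p` is the row of `M_{a+1,b}(Φ)` at the prefix `x·p`.
[cite: Nisan1991, §2] -/
theorem wordFlattening_slice {d a b : ℕ} (h : a + b = d) (x : Fin m)
    (Φ : (Fin (d + 1) → Fin m) → F) (p : Fin a → Fin m) :
    wordFlattening (slice x Φ) a b h p =
      wordFlattening Φ (a + 1) b (by omega) (Fin.cons x p) := by
  funext s
  rw [wordFlattening_apply, wordFlattening_apply, slice]
  congr 1
  funext t
  rw [Fin.append_cons, Function.comp_apply]
  refine Fin.cases ?_ (fun t' => ?_) t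
  · have h0 : Fin.cast (Nat.add_right_comm a 1 b) (Fin.cast (by omega) (0 : Fin (d + 1))) = 0 :=
      Fin.ext rfl
    rw [h0, Fin.cons_zero, Fin.cons_zero]
  · have hs : Fin.cast (Nat.add_right_comm a 1 b) (Fin.cast (by omega) t'.succ) =
        (Fin.cast h.symm t').succ := Fin.ext rfl
    rw [hs, Fin.cons_succ, Fin.cons_succ]

omit [Field F] in
/-- The rows of the slices at the cut `a | b` are rows of the original tensors at the cut
`a + 1 | b`. [cite: Nisan1991, §2] -/
theorem rowSet_slice_subset {d : ℕ} (𝒮 : Set ((Fin (d + 1) → Fin m) → F)) (a b : ℕ)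
    (h : a + b = d) :
    rowSet {Φ' | ∃ x, ∃ Φ ∈ 𝒮, Φ' = slice x Φ} a b h ⊆ rowSet 𝒮 (a + 1) b (by omega) := by
  intro r hr
  simp only [rowSet, Set.mem_iUnion, Set.mem_range, exists_prop, Set.mem_setOf_eq] at hr ⊢
  obtain ⟨Φ', ⟨x, Φ, hΦ, rfl⟩, p, rfl⟩ := hr
  exact ⟨Φ, hΦ, Fin.cons x p, (wordFlattening_slice h x Φ p).symm⟩

/-- The slice span of `span 𝒮` is spanned by the slices of the members of `𝒮`.
[cite: Nisan1991, Thm. 1 (proof)] -/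
theorem sliceSpan_span_le {d : ℕ} (𝒮 : Set ((Fin (d + 1) → Fin m) → F)) :
    sliceSpan (Submodule.span F 𝒮) ≤ Submodule.span F {Φ' | ∃ x, ∃ Φ ∈ 𝒮, Φ' = slice x Φ} := by
  refine iSup_le fun x => ?_
  rw [Submodule.map_span]
  refine Submodule.span_mono ?_
  rintro _ ⟨Φ, hΦ, rfl⟩
  exact ⟨x, Φ, hΦ, rfl⟩

/-- **The row-rank condition implies goodness**: if for every cut `a + b = d` the rows of the
flattenings of the tensors in `𝒮` span a space of dimension `≤ w`, then `span 𝒮` is `w`-good.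
[cite: Nisan1991, Thm. 1 (proof)] -/
theorem good_span_of_rank_le (w : ℕ) : ∀ (d : ℕ) (𝒮 : Set ((Fin d → Fin m) → F)),
    (∀ (a b : ℕ) (h : a + b = d), finrank F (Submodule.span F (rowSet 𝒮 a b h)) ≤ w) →
    Good w d (Submodule.span F 𝒮)
  | 0, 𝒮, H => by
    have h := H 0 0 (Nat.zero_add 0)
    rw [rowSet_zero] at h
    exact h
  | d + 1, 𝒮, H => by
    refine ⟨?_, ?_⟩
    · have h := H 0 (d + 1) (Nat.zero_add _)
      rw [rowSet_zero] at h
      exact h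
    · refine Good.mono w d (good_span_of_rank_le w d _ fun a b h => ?_) (sliceSpan_span_le 𝒮)
      exact (Submodule.finrank_mono (Submodule.span_mono (rowSet_slice_subset 𝒮 a b h))).trans
        (H (a + 1) b (by omega))

/-- For a single tensor the row set at a cut is the set of rows of its flattening, whose span has
dimension `rank M_{a,b}(Ψ)`. [cite: Nisan1991, §2] -/
theorem finrank_span_rowSet_singleton {d : ℕ} (Ψ : (Fin d → Fin m) → F) (a b : ℕ)
    (h : a + b = d) :
    finrank F (Submodule.span F (rowSet {Ψ} a b h)) = (wordFlattening Ψ a b h).rank := by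
  have hset : rowSet {Ψ} a b h = Set.range (wordFlattening Ψ a b h).row := by
    ext r
    simp [rowSet, Matrix.row]
  rw [hset, Matrix.rank_eq_finrank_span_row]

/-! ### (⇒): a width-`w` program bounds every flattening rank -/

/-- Splitting the transfer-matrix product at the cut `a | b`: the flattening of a tensor computed
by a width-`w` program factors through `F^w` ("`M_k = L_k R_k`").
[cite: BlaserDorflerIkenmeyer2020, Prop 12 (arXiv; = CCC 2021 Prop 6.6), proof] -/
theorem wordFlattening_eq_mul {a b w : ℕ} (C : Fin (a + b) → Fin m → Matrix (Fin w) (Fin w) F)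
    (u v : Fin w → F) (Ψ : (Fin (a + b) → Fin m) → F) (hΨ : ∀ i, Ψ i = abpEval C u v i) :
    wordFlattening Ψ a b rfl =
      (Matrix.of fun p : Fin a → Fin m =>
          u ᵥ* (List.ofFn fun t : Fin a => C (Fin.castLE (Nat.le_add_right a b) t) (p t)).prod) *
        (Matrix.of fun (k : Fin w) (s : Fin b → Fin m) =>
          ((List.ofFn fun t : Fin b => C (Fin.natAdd a t) (s t)).prod *ᵥ v) k) := by
  ext p s
  rw [wordFlattening_apply, hΨ, abpEval, Matrix.mul_apply]
  have hcast : (List.ofFn fun t => C t (Fin.append p s (Fin.cast (rfl : a + b = a + b).symm t))) =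
      List.ofFn fun t => C t (Fin.append p s t) := rfl
  have hleft : ∀ t : Fin a, Fin.append p s (Fin.castLE (Nat.le_add_right a b) t) = p t :=
    fun t => Fin.append_left p s t
  rw [hcast, List.ofFn_add, List.prod_append]
  simp only [hleft, Fin.append_right]
  rw [← Matrix.mulVec_mulVec, Matrix.dotProduct_mulVec]
  rfl

/-- **(⇒) of the width theorem (Nisan's rank bound)**: a tensor computed by a program of width
`≤ w` has all flattening ranks `≤ w`. [cite: BlaserDorflerIkenmeyer2020, Prop 12 (arXiv; = CCC 2021 Prop 6.6)] -/
theorem rank_wordFlattening_le_of_hasNcABPWidthLE {d w : ℕ} {Ψ : (Fin d → Fin m) → F}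
    (hΨ : HasNcABPWidthLE w Ψ) (a b : ℕ) (h : a + b = d) :
    (wordFlattening Ψ a b h).rank ≤ w := by
  subst h
  obtain ⟨C, u, v, hC⟩ := hΨ
  rw [wordFlattening_eq_mul C u v Ψ hC]
  refine (Matrix.rank_mul_le_left _ _).trans ?_
  exact (Matrix.rank_le_card_width _).trans (by rw [Fintype.card_fin])

end Nisan

/-- **Nisan's width theorem in transfer-matrix form (BDI Prop. 6.6, clauses 1 and 4, for every
tensor)**: `Ψ` has a noncommutative ABP of width `≤ w` iff every flattening `M_k(Ψ)` has rank
`≤ w`. [cite: BlaserDorflerIkenmeyer2020, Prop 12 (arXiv; = CCC 2021 Prop 6.6)] -/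
theorem hasNcABPWidthLE_iff_wordTTRank_le {F : Type*} [Field F] {m d w : ℕ}
    (Ψ : (Fin d → Fin m) → F) : HasNcABPWidthLE w Ψ ↔ wordTTRank Ψ ≤ w := by
  constructor
  · intro h
    exact wordTTRank_le_iff.2 (Nisan.rank_wordFlattening_le_of_hasNcABPWidthLE h)
  · intro h
    have H := wordTTRank_le_iff.1 h
    have hgood : Nisan.Good w d (Submodule.span F {Ψ}) :=
      Nisan.good_span_of_rank_le w d {Ψ} fun a b hab => by
        rw [Nisan.finrank_span_rowSet_singleton]
        exact H a b hab
    obtain ⟨C, v, L, hL⟩ := Nisan.exists_abp_of_good w d _ hgood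
    exact ⟨C, L Ψ, v, fun i => hL Ψ (Submodule.mem_span_singleton_self Ψ) i⟩

end BDI2020

/-- **BDI Prop. 6.6 — DISCHARGED** (by `BDI2020.hasNcABPWidthLE_iff_wordTTRank_le`; the symmetry
hypothesis is not used). [cite: BlaserDorflerIkenmeyer2020, Prop 12 (arXiv; = CCC 2021 Prop 6.6)] -/
theorem BDI2020_prop_6_6_holds : BDI2020_prop_6_6 :=
  fun _ _ _ Ψ _ => BDI2020.hasNcABPWidthLE_iff_wordTTRank_le Ψ

end Literature.Computability.AlgebraicComplexity

end
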